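import Summits.QuantumFields.BalabanUV.Beta.FP.PerfectSymbol166Pos
import Literature.MathematicalPhysics.QuantumFieldTheory.Balaban1983to89.Beta.SymbolExpansion

/-!
# `BalabanUV.Beta.FP.PerfectSymbol166FlatFactors` — road «FP» for binder row D1, leaf H2-P of the horizontal route, SUPPLIER sub-row «W166-FLAT», PART 1
# (`HOME/b2b-balaban-beta-d1-p3/LEAVES-FP.md`, `H2-DESIGN.md` §5): second-order flatness at zero momentum of the FACTORS of the continuum (1.66) multiplier
# on the real Brillouin zone — the averaging weight `u_∞(0;·)`, `U_∞(0;·)`, `c_∞(λ;·)`, the Laplacian factor `D0Inf`, the alias remainder `R̃_∞`, and `Y_∞(λ;·)`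

HONEST DEPENDENCY (page 1, mandatory): continuum YM on T⁴ ⇐ BetaPertH ∧ nine spine estimates (0/9 proved); BetaPertH ⇐ (D1) ∧ (D4) ∧ CAP+tail;
G-an2-4 gates asym, D1 and NE2/3/4.  HONEST FRAMING (cell contract, verbatim): «discharging `BetaPertH` makes Bałaban's UV stability UNCONDITIONAL —
a real constructive-QFT result; it is NOT the continuum limit and NOT the Clay problem.»  THIS MODULE DISCHARGES NOTHING of the wall: elementary real
analysis ([folklore]) on the CLOSED FORM `W166Inf = Π_{λ∉{μ,ν}} YcInf λ / F66Inf` of `FP/PerfectSymbol166` (p222342) over tree bounds BY NAME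
(`B5Symbol166Strip.norm_Rt_le`, `PerfectSymbol166.tendsto_Rt`/`norm_F66Inf_ge`, `B4Strip.S1r_ge`, Mathlib `Real.cos_bound`/`Real.one_sub_sq_div_two_le_cos`).
No `def … : Prop`; nothing cited as a hypothesis; 0 sorry; 0 wall binders; NOT D1, NOT BetaPertH, NOT continuum, NOT Clay.

ABSOLUTE RULE (cell charter, verbatim): «No internally-minted statement may enter as a cited fact. Every hypothesis is either kernel-proved in this package or a
verbatim quotation of a PUBLISHED theorem with page reference. The manuscript(s) under audit are NOT citable for their own disputed steps — they are the thing
under adjudication; programme-internal (2001/route/tribunal) claims are never citable.»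

WHY (road FP, leaf H2-P-KER, `H2-DESIGN.md` §5).  The unconstrained perfect propagator symbol is `PinfSym s ph = (maxwellMat (Re W_∞(s)) ph + ph⊗ph†)⁻¹`
(`FP/PerfectPropagatorSymbol`, p231001).  At the constant weights `W ≡ 1` the completed matrix is `‖ph‖²·𝟙`, so the split `PinfSym = 𝟙/‖ph‖² + B` of
H2-P-KER has `B` BOUNDED on the punctured zone exactly when `maxwellMat (W_∞ − 1) ph = O(‖ph‖⁴)`, i.e. when `W_∞(s) − 1 = O(‖ph(s)‖²) = O(Σ_a (2 − 2cos s_a))`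
— the SECOND-ORDER flatness of the perfect multiplier at zero momentum.  `H2-DESIGN.md` §5 uses this silently («`M + p̂p̂† = |p̂|²·A(p)` with … `A(0) = 1` ⟹
`B := (A⁻¹ − 1)/|p̂|²` BOUNDED»).  The tree had `W_∞(·;0) = 1` (`W166Inf_zero`) and the two-sided bounds `(4/π²)^{d+2} ≤ Re W_∞ ≤ (π²/4)^{2d+4}`
(`PerfectSymbol166Pos`), but no modulus of continuity at `0`.  The pair of files `PerfectSymbol166FlatFactors` (factors) / `PerfectSymbol166Flat` (assembly)
proves it, in the currency `E(s) := Σ_a S1r (s a) = Σ_a (2 − 2cos s_a) = Σ_a ‖e^{is_a} − 1‖² = 2·ε(s)` (`ε` = `LatticeModels.dispersion`, the symbol of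
`latticeGreen`).

WHAT (this part; three explicit real CONSTANTS `BR`, `CY`, `MY` — closed numerals in `d`, [our object]).
* §1 [folklore] toolkit: `‖Π_{i∈s} a_i − 1‖ ≤ M^{|s|}·Σ_{i∈s} δ_i` for `‖a_i‖ ≤ M`, `1 ≤ M`, `‖a_i − 1‖ ≤ δ_i` (`norm_prod_sub_one_le`); `‖a^n − 1‖ ≤ n‖a − 1‖`
  for `‖a‖ ≤ 1`; the one-coordinate facts on `|t| ≤ π`: `t² ≤ (π²/4)·S1r t` (`B4Strip.S1r_ge`), `S1r t ≤ t²` (`Beta.SymbolExpansion.S1r_le_sq` BY NAME), `t² − S1r t ≤ t⁴` (`Real.cos_bound` on `|t| ≤ 1`,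
  trivial on `1 ≤ |t|`), `S1r t ≤ 4` (`B5Prop11Leaves.S1r_le_four` BY NAME); the H2-P currencies `S1r t = ‖cexp (t·I) − 1‖²`, `Σ_a S1r (s a) = 2·Σ_a (1 − cos s_a)`.
* §2 the `l = 0` averaging weight on the reals: `uInf 0 t = S1r t / t²` (`t ≠ 0`), `‖uInf 0 t‖ ≤ 1`, **`‖uInf 0 t − 1‖ ≤ (π²/4)·S1r t`**; hence
  `‖UInf 0 (ofRealVec s)‖ ≤ 1`, `‖UInf 0 (ofRealVec s) − 1‖ ≤ (π²/4)·E(s)`, `‖cfacInf λ − 1‖ ≤ (π²/2)·E(s)`, `‖cfacInf λ‖ ≤ 1`.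
* §3 `‖D0Inf (ofRealVec s)‖ = Σ s_ν² ≤ (π²/4)·E(s)`; `‖RtInf λ (ofRealVec s)‖ ≤ BR d := 66·132^d` (the level-`n` bound `norm_Rt_le` passed to the limit
  `tendsto_Rt`); **`‖YcInf λ (ofRealVec s) − 1‖ ≤ CY d · E(s)`** (`CY d = (π²/4)(2 + BR d)`), `‖YcInf λ (ofRealVec s)‖ ≤ MY d := 1 + CY d·4d`.
PART 2 (`FP/PerfectSymbol166Flat`) assembles `F_∞` and `W_∞`.
Provenance: binder row G-an2-4 owner lineage gan24-p3, gen 16 (prover-b2b-balaban-gan24-p3-g16-0), 2026-08-20; supplier of road FP's H2-P-KER (owner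
b2b-balaban-beta-d1-p3).
-/

noncomputable section

namespace Summit.QuantumFields.BalabanUV.Beta.FP.PerfectSymbol166FlatFactors

open Filter Topology Finset
open scoped BigOperators
open Literature.MathematicalPhysics.QuantumFieldTheory.Balaban1983to89
open B4Strip (S1 S1r S1_ofReal S1r_ge S1r_nonneg Strip ofRealVec)
open B4StripCauchy (Fat strip_subset_fat rOf rOf_pos rOf_le d_mul_rOf_sq_le)
open B4ContourShift (BZ ofRealVec_mem_Strip)
open B5Symbol166 (Rt)
open B5Symbol166Strip (kappa166 kappa166_pos norm_Rt_le)
open B5Prop11Leaves (S1r_le_four)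
open Literature.MathematicalPhysics.QuantumFieldTheory.Balaban1983to89.Beta.SymbolExpansion (S1r_le_sq)
open Summit.QuantumFields.BalabanUV.Beta.FP.PerfectSymbolAlias (uInf UInf)
open Summit.QuantumFields.BalabanUV.Beta.FP.PerfectSymbol166 (RtInf cfacInf D0Inf YcInf F66Inf W166Inf tendsto_Rt norm_F66Inf_ge)
open Summit.QuantumFields.BalabanUV.Beta.FP.PerfectSymbol166Pos (abs_le_pi_of_mem_BZ)

variable {d : ℕ}

/-! ## §1 Toolkit: products and powers close to `1`; one-coordinate trigonometric bounds -/

/-- [folklore] `‖Π_{i∈s} a_i − 1‖ ≤ M^{|s|} · Σ_{i∈s} δ_i` when `‖a_i‖ ≤ M` (`1 ≤ M`) and `‖a_i − 1‖ ≤ δ_i` on `s` (telescoping). -/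
theorem norm_prod_sub_one_le {ι : Type*} [DecidableEq ι] (s : Finset ι) (a : ι → ℂ) (δ : ι → ℝ) {M : ℝ} (hM : 1 ≤ M)
    (ha : ∀ i ∈ s, ‖a i‖ ≤ M) (hδ : ∀ i ∈ s, ‖a i - 1‖ ≤ δ i) :
    ‖∏ i ∈ s, a i - 1‖ ≤ M ^ s.card * ∑ i ∈ s, δ i := by
  induction s using Finset.induction_on with
  | empty => simp
  | @insert j s hj ih =>
    have ha' : ∀ i ∈ s, ‖a i‖ ≤ M := fun i hi => ha i (Finset.mem_insert_of_mem hi)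
    have hδ' : ∀ i ∈ s, ‖a i - 1‖ ≤ δ i := fun i hi => hδ i (Finset.mem_insert_of_mem hi)
    have hP := ih ha' hδ'
    have haj := ha j (Finset.mem_insert_self j s)
    have hδj := hδ j (Finset.mem_insert_self j s)
    have hδj0 : 0 ≤ δ j := (norm_nonneg _).trans hδj
    have hsum0 : 0 ≤ ∑ i ∈ s, δ i := Finset.sum_nonneg fun i hi => (norm_nonneg _).trans (hδ' i hi)
    have hM0 : 0 ≤ M := zero_le_one.trans hM
    have hMk : 1 ≤ M ^ (s.card + 1) := one_le_pow₀ hM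
    rw [Finset.prod_insert hj, Finset.sum_insert hj, Finset.card_insert_of_notMem hj]
    have e : a j * ∏ i ∈ s, a i - 1 = a j * (∏ i ∈ s, a i - 1) + (a j - 1) := by ring
    rw [e]
    calc ‖a j * (∏ i ∈ s, a i - 1) + (a j - 1)‖
        ≤ ‖a j‖ * ‖∏ i ∈ s, a i - 1‖ + ‖a j - 1‖ := by
          refine (norm_add_le _ _).trans ?_; rw [norm_mul]
      _ ≤ M * (M ^ s.card * ∑ i ∈ s, δ i) + δ j := by
          gcongr
      _ = M ^ (s.card + 1) * ∑ i ∈ s, δ i + δ j := by ring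
      _ ≤ M ^ (s.card + 1) * ∑ i ∈ s, δ i + M ^ (s.card + 1) * δ j := by
          have : δ j ≤ M ^ (s.card + 1) * δ j := le_mul_of_one_le_left hδj0 hMk
          linarith
      _ = M ^ (s.card + 1) * (δ j + ∑ i ∈ s, δ i) := by ring

/-- [folklore] `‖a^n − 1‖ ≤ n · ‖a − 1‖` when `‖a‖ ≤ 1`. -/
theorem norm_pow_sub_one_le (a : ℂ) (ha : ‖a‖ ≤ 1) (n : ℕ) : ‖a ^ n - 1‖ ≤ n * ‖a - 1‖ := by
  induction n with
  | zero => simp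
  | succ n ih =>
    have e : a ^ (n + 1) - 1 = a * (a ^ n - 1) + (a - 1) := by ring
    rw [e]
    calc ‖a * (a ^ n - 1) + (a - 1)‖ ≤ ‖a‖ * ‖a ^ n - 1‖ + ‖a - 1‖ := by
          refine (norm_add_le _ _).trans ?_; rw [norm_mul]
      _ ≤ 1 * (n * ‖a - 1‖) + ‖a - 1‖ := by gcongr
      _ = ((n + 1 : ℕ) : ℝ) * ‖a - 1‖ := by push_cast; ring

/-- [folklore] Jordan in the `S1r` currency: `t² ≤ (π²/4)·(2 − 2cos t)` for `|t| ≤ π` (`B4Strip.S1r_ge`). -/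
theorem sq_le_S1r (t : ℝ) (ht : |t| ≤ Real.pi) : t ^ 2 ≤ Real.pi ^ 2 / 4 * S1r t := by
  have h := S1r_ge t ht
  have hπ : 0 < Real.pi ^ 2 := by positivity
  rw [div_le_iff₀ hπ] at h
  nlinarith

/-- [folklore] the quartic remainder with constant ONE: `t² − (2 − 2cos t) ≤ t⁴` (on `|t| ≤ 1` from `Real.cos_bound`, `5/48 ≤ 1`; on `1 ≤ |t|` from
`2 − 2cos t ≥ 0` and `t² ≤ t⁴`). -/
theorem sq_sub_S1r_le_pow_four (t : ℝ) : t ^ 2 - S1r t ≤ t ^ 4 := by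
  rcases le_or_gt |t| 1 with h | h
  · have hb := Real.cos_bound h
    have h1 := (abs_le.mp hb).2
    have h4 : |t| ^ 4 = t ^ 4 := by rw [show |t| ^ 4 = (|t| ^ 2) ^ 2 by ring, sq_abs]; ring
    rw [h4] at h1
    unfold S1r
    nlinarith [sq_nonneg (t ^ 2)]
  · have ht2 : 1 ≤ t ^ 2 := by
      have : 1 ≤ |t| ^ 2 := by nlinarith [abs_nonneg t]
      rwa [sq_abs] at this
    have hS := S1r_nonneg t
    nlinarith

/-- [folklore] `E(s) := Σ_a S1r (s a) ≥ 0`. -/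
theorem sum_S1r_nonneg (s : Fin d → ℝ) : 0 ≤ ∑ a, S1r (s a) := Finset.sum_nonneg fun a _ => S1r_nonneg (s a)

/-- [folklore] `E(s) ≤ 4d`. -/
theorem sum_S1r_le (s : Fin d → ℝ) : ∑ a, S1r (s a) ≤ 4 * d := by
  calc ∑ a, S1r (s a) ≤ ∑ _a : Fin d, (4 : ℝ) := Finset.sum_le_sum fun a _ => S1r_le_four _
    _ = 4 * d := by simp [mul_comm]

/-- [folklore] each summand is dominated by the sum: `S1r (s a) ≤ E(s)`. -/
theorem S1r_le_sum (s : Fin d → ℝ) (a : Fin d) : S1r (s a) ≤ ∑ b, S1r (s b) :=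
  Finset.single_le_sum (fun b _ => S1r_nonneg (s b)) (Finset.mem_univ a)

/-- [folklore] THE H2-P CURRENCY: `S1r t = ‖e^{it} − 1‖²`, so `Σ_a S1r (s a) = Σ_a ‖cexp (s_a·I) − 1‖² = ‖p̂(s)‖²` (= `2·ε(s)`, `ε` the dispersion
`Σ_a (1 − cos s_a)`). -/
theorem S1r_eq_norm_d1_sq (t : ℝ) : S1r t = ‖Complex.exp ((t : ℂ) * Complex.I) - 1‖ ^ 2 := by
  rw [Complex.sq_norm, Complex.normSq_apply]
  have hre : (Complex.exp ((t : ℂ) * Complex.I) - 1).re = Real.cos t - 1 := by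
    rw [Complex.sub_re, Complex.exp_ofReal_mul_I_re, Complex.one_re]
  have him : (Complex.exp ((t : ℂ) * Complex.I) - 1).im = Real.sin t := by
    rw [Complex.sub_im, Complex.exp_ofReal_mul_I_im, Complex.one_im, sub_zero]
  rw [hre, him]
  unfold S1r
  nlinarith [Real.sin_sq_add_cos_sq t]

/-- [folklore] summed form. -/
theorem sum_S1r_eq_sum_norm_d1_sq (s : Fin d → ℝ) :
    ∑ a, S1r (s a) = ∑ a, ‖Complex.exp ((s a : ℂ) * Complex.I) - 1‖ ^ 2 :=
  Finset.sum_congr rfl fun a _ => S1r_eq_norm_d1_sq (s a)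

/-- [folklore] and the dispersion form `Σ_a S1r (s a) = 2·Σ_a (1 − cos s_a)`. -/
theorem sum_S1r_eq_two_mul_dispersion (s : Fin d → ℝ) : ∑ a, S1r (s a) = 2 * ∑ a, (1 - Real.cos (s a)) := by
  rw [Finset.mul_sum]; exact Finset.sum_congr rfl fun a _ => by unfold S1r; ring

/-! ## §2 The `l = 0` averaging weight on the reals -/

/-- [folklore] `u_∞(0; t) = (2 − 2cos t)/t²` for real `t ≠ 0`. -/
theorem uInf_zero_ofReal {t : ℝ} (ht : t ≠ 0) : uInf 0 (t : ℂ) = (((S1r t / t ^ 2 : ℝ)) : ℂ) := by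
  unfold uInf
  have htc : (t : ℂ) ≠ 0 := Complex.ofReal_ne_zero.mpr ht
  rw [if_neg (fun h => htc h.2), S1_ofReal]
  push_cast; ring

/-- [folklore] `u_∞(0; 0) = 1`. -/
theorem uInf_zero_zero : uInf 0 ((0 : ℝ) : ℂ) = 1 := by
  unfold uInf; simp

/-- [folklore] `‖u_∞(0; t)‖ ≤ 1` on the reals (`2 − 2cos t ≤ t²`). -/
theorem norm_uInf_zero_ofReal_le_one (t : ℝ) : ‖uInf 0 (t : ℂ)‖ ≤ 1 := by
  rcases eq_or_ne t 0 with rfl | ht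
  · rw [uInf_zero_zero, norm_one]
  · rw [uInf_zero_ofReal ht, Complex.norm_real, Real.norm_eq_abs]
    have ht2 : 0 < t ^ 2 := by positivity
    rw [abs_of_nonneg (div_nonneg (S1r_nonneg t) ht2.le), div_le_one ht2]
    exact S1r_le_sq t

/-- [folklore] **SECOND-ORDER FLATNESS OF THE AVERAGING WEIGHT**: `‖u_∞(0; t) − 1‖ ≤ (π²/4)·(2 − 2cos t)` for `|t| ≤ π`
(`1 − (2 − 2cos t)/t² = (t² − S1r t)/t² ≤ t² ≤ (π²/4) S1r t`). -/
theorem norm_uInf_zero_ofReal_sub_one_le {t : ℝ} (ht : |t| ≤ Real.pi) : ‖uInf 0 (t : ℂ) - 1‖ ≤ Real.pi ^ 2 / 4 * S1r t := by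
  rcases eq_or_ne t 0 with rfl | ht0
  · rw [uInf_zero_zero, sub_self, norm_zero]; exact mul_nonneg (by positivity) (S1r_nonneg 0)
  · rw [uInf_zero_ofReal ht0, ← Complex.ofReal_one, ← Complex.ofReal_sub, Complex.norm_real, Real.norm_eq_abs]
    have ht2 : 0 < t ^ 2 := by positivity
    have e : S1r t / t ^ 2 - 1 = -((t ^ 2 - S1r t) / t ^ 2) := by field_simp; ring
    rw [e, abs_neg, abs_of_nonneg (div_nonneg (by linarith [S1r_le_sq t]) ht2.le), div_le_iff₀ ht2]
    have h4 := sq_sub_S1r_le_pow_four t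
    have hJ := sq_le_S1r t ht
    calc t ^ 2 - S1r t ≤ t ^ 4 := h4
      _ = t ^ 2 * t ^ 2 := by ring
      _ ≤ Real.pi ^ 2 / 4 * S1r t * t ^ 2 := mul_le_mul_of_nonneg_right hJ ht2.le

/-- [folklore] `‖U_∞(0; s)‖ ≤ 1` on the real zone. -/
theorem norm_UInf_zero_ofReal_le_one (s : Fin d → ℝ) : ‖UInf 0 (ofRealVec s)‖ ≤ 1 := by
  unfold UInf
  calc ‖∏ ν, uInf ((0 : Fin d → ℤ) ν) (ofRealVec s ν)‖ ≤ ∏ ν, ‖uInf ((0 : Fin d → ℤ) ν) (ofRealVec s ν)‖ := Finset.norm_prod_le _ _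
    _ ≤ ∏ _ν : Fin d, (1 : ℝ) := Finset.prod_le_prod (fun _ _ => norm_nonneg _) fun ν _ => by
          simpa [ofRealVec] using norm_uInf_zero_ofReal_le_one (s ν)
    _ = 1 := by simp

/-- [folklore] `‖U_∞(0; s) − 1‖ ≤ (π²/4)·E(s)` on the real zone. -/
theorem norm_UInf_zero_ofReal_sub_one_le {s : Fin d → ℝ} (hs : s ∈ BZ d) :
    ‖UInf 0 (ofRealVec s) - 1‖ ≤ Real.pi ^ 2 / 4 * ∑ a, S1r (s a) := by
  classical
  unfold UInf
  have h := norm_prod_sub_one_le (Finset.univ : Finset (Fin d)) (fun ν => uInf ((0 : Fin d → ℤ) ν) (ofRealVec s ν))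
    (fun ν => Real.pi ^ 2 / 4 * S1r (s ν)) (M := 1) le_rfl
    (fun ν _ => by simpa [ofRealVec] using norm_uInf_zero_ofReal_le_one (s ν))
    (fun ν _ => by simpa [ofRealVec] using norm_uInf_zero_ofReal_sub_one_le (abs_le_pi_of_mem_BZ hs ν))
  rw [one_pow, one_mul, ← Finset.mul_sum] at h
  exact h

/-- [folklore] `‖c_∞(λ; s)‖ ≤ 1` on the real zone. -/
theorem norm_cfacInf_ofReal_le_one (s : Fin d → ℝ) (lam : Fin d) : ‖cfacInf lam (ofRealVec s)‖ ≤ 1 := by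
  unfold cfacInf
  rw [norm_mul]
  have h1 := norm_UInf_zero_ofReal_le_one s
  have h2 : ‖uInf 0 (ofRealVec s lam)‖ ≤ 1 := by simpa [ofRealVec] using norm_uInf_zero_ofReal_le_one (s lam)
  calc ‖UInf 0 (ofRealVec s)‖ * ‖uInf 0 (ofRealVec s lam)‖ ≤ 1 * 1 := by gcongr
    _ = 1 := one_mul 1

/-- [folklore] **`‖c_∞(λ; s) − 1‖ ≤ (π²/2)·E(s)`** on the real zone. -/
theorem norm_cfacInf_ofReal_sub_one_le {s : Fin d → ℝ} (hs : s ∈ BZ d) (lam : Fin d) :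
    ‖cfacInf lam (ofRealVec s) - 1‖ ≤ Real.pi ^ 2 / 2 * ∑ a, S1r (s a) := by
  unfold cfacInf
  set A := UInf 0 (ofRealVec s)
  set b := uInf 0 (ofRealVec s lam)
  have hA1 := norm_UInf_zero_ofReal_le_one s
  have hA := norm_UInf_zero_ofReal_sub_one_le hs
  have hb : ‖b - 1‖ ≤ Real.pi ^ 2 / 4 * S1r (s lam) := by
    simpa [b, ofRealVec] using norm_uInf_zero_ofReal_sub_one_le (abs_le_pi_of_mem_BZ hs lam)
  have hE := sum_S1r_nonneg s
  have hlam := S1r_le_sum s lam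
  have e : A * b - 1 = A * (b - 1) + (A - 1) := by ring
  rw [e]
  calc ‖A * (b - 1) + (A - 1)‖ ≤ ‖A‖ * ‖b - 1‖ + ‖A - 1‖ := by
        refine (norm_add_le _ _).trans ?_; rw [norm_mul]
    _ ≤ 1 * (Real.pi ^ 2 / 4 * S1r (s lam)) + Real.pi ^ 2 / 4 * ∑ a, S1r (s a) := by gcongr
    _ ≤ Real.pi ^ 2 / 2 * ∑ a, S1r (s a) := by nlinarith [Real.pi_pos]

/-! ## §3 The continuum Laplacian factor, the alias remainder, the factor `Y_∞` -/

/-- [folklore] `D0Inf` is real on the real zone: `D0Inf (ofRealVec s) = Σ_ν s_ν²`. -/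
theorem D0Inf_ofReal (s : Fin d → ℝ) : D0Inf (ofRealVec s) = ((∑ ν, s ν ^ 2 : ℝ) : ℂ) := by
  unfold D0Inf ofRealVec; push_cast; rfl

/-- [folklore] `‖D0Inf (ofRealVec s)‖ ≤ (π²/4)·E(s)` on the real zone (Jordan coordinatewise). -/
theorem norm_D0Inf_ofReal_le {s : Fin d → ℝ} (hs : s ∈ BZ d) : ‖D0Inf (ofRealVec s)‖ ≤ Real.pi ^ 2 / 4 * ∑ a, S1r (s a) := by
  rw [D0Inf_ofReal, Complex.norm_real, Real.norm_eq_abs, abs_of_nonneg (Finset.sum_nonneg fun ν _ => sq_nonneg (s ν)), Finset.mul_sum]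
  exact Finset.sum_le_sum fun ν _ => sq_le_S1r (s ν) (abs_le_pi_of_mem_BZ hs ν)

/-- [our object] the alias-remainder bound `BR d := 66·132^d` (`B5Symbol166Strip.norm_Rt_le`'s constant). -/
def BR (d : ℕ) : ℝ := 66 * 132 ^ d

/-- [folklore] `1 ≤ BR d`. -/
theorem one_le_BR (d : ℕ) : 1 ≤ BR d := by
  unfold BR; have : (1 : ℝ) ≤ 132 ^ d := one_le_pow₀ (by norm_num); nlinarith

/-- [folklore] a real momentum of the zone lies in the fat box of radius `rOf d`. -/
theorem ofRealVec_mem_Fat_rOf {s : Fin d → ℝ} (hs : s ∈ BZ d) : ofRealVec s ∈ Fat d (rOf d) :=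
  strip_subset_fat (rOf_pos d).le (rOf_pos d).le (ofRealVec_mem_Strip le_rfl hs)

/-- [folklore] **`‖R̃_∞(λ; s)‖ ≤ 66·132^d`** on the real zone (the level-`n` bound `norm_Rt_le` passes to the limit `tendsto_Rt`). -/
theorem norm_RtInf_ofReal_le {s : Fin d → ℝ} (hs : s ∈ BZ d) (lam : Fin d) : ‖RtInf lam (ofRealVec s)‖ ≤ BR d := by
  have hfat := ofRealVec_mem_Fat_rOf hs
  have ht := (tendsto_Rt (rOf_le d) (d_mul_rOf_sq_le d) hfat lam).norm
  exact le_of_tendsto' ht fun j => norm_Rt_le (j + 1) (rOf_le d) (d_mul_rOf_sq_le d) hfat lam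

/-- [our object] the flatness constant of `Y_∞`: `CY d := (π²/4)·(2 + BR d)`. -/
def CY (d : ℕ) : ℝ := Real.pi ^ 2 / 4 * (2 + BR d)

/-- [folklore] `0 ≤ CY d`. -/
theorem CY_nonneg (d : ℕ) : 0 ≤ CY d := by unfold CY; have := one_le_BR d; positivity

/-- [folklore] **`‖Y_∞(λ; s) − 1‖ ≤ CY d · E(s)`** on the real zone. -/
theorem norm_YcInf_ofReal_sub_one_le {s : Fin d → ℝ} (hs : s ∈ BZ d) (lam : Fin d) :
    ‖YcInf lam (ofRealVec s) - 1‖ ≤ CY d * ∑ a, S1r (s a) := by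
  unfold YcInf
  have h1 := norm_cfacInf_ofReal_sub_one_le hs lam
  have h2 := norm_D0Inf_ofReal_le hs
  have h3 := norm_RtInf_ofReal_le hs lam
  have hE := sum_S1r_nonneg s
  have e : cfacInf lam (ofRealVec s) + D0Inf (ofRealVec s) * RtInf lam (ofRealVec s) - 1
      = (cfacInf lam (ofRealVec s) - 1) + D0Inf (ofRealVec s) * RtInf lam (ofRealVec s) := by ring
  rw [e]
  calc ‖(cfacInf lam (ofRealVec s) - 1) + D0Inf (ofRealVec s) * RtInf lam (ofRealVec s)‖
      ≤ ‖cfacInf lam (ofRealVec s) - 1‖ + ‖D0Inf (ofRealVec s)‖ * ‖RtInf lam (ofRealVec s)‖ := by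
        refine (norm_add_le _ _).trans ?_; rw [norm_mul]
    _ ≤ Real.pi ^ 2 / 2 * ∑ a, S1r (s a) + (Real.pi ^ 2 / 4 * ∑ a, S1r (s a)) * BR d := by
        gcongr
    _ = CY d * ∑ a, S1r (s a) := by unfold CY; ring

/-- [our object] the sup bound of `Y_∞` on the zone: `MY d := 1 + CY d · 4d`. -/
def MY (d : ℕ) : ℝ := 1 + CY d * (4 * d)

/-- [folklore] `1 ≤ MY d`. -/
theorem one_le_MY (d : ℕ) : 1 ≤ MY d := by unfold MY; have := CY_nonneg d; nlinarith [Nat.cast_nonneg (α := ℝ) d]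

/-- [folklore] `‖Y_∞(λ; s)‖ ≤ MY d` on the real zone. -/
theorem norm_YcInf_ofReal_le {s : Fin d → ℝ} (hs : s ∈ BZ d) (lam : Fin d) : ‖YcInf lam (ofRealVec s)‖ ≤ MY d := by
  have h := norm_YcInf_ofReal_sub_one_le hs lam
  have hE := sum_S1r_le s
  have hE0 := sum_S1r_nonneg s
  have hC := CY_nonneg d
  have e : YcInf lam (ofRealVec s) = (YcInf lam (ofRealVec s) - 1) + 1 := by ring
  rw [e]
  calc ‖(YcInf lam (ofRealVec s) - 1) + 1‖ ≤ ‖YcInf lam (ofRealVec s) - 1‖ + ‖(1 : ℂ)‖ := norm_add_le _ _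
    _ ≤ CY d * ∑ a, S1r (s a) + 1 := by rw [norm_one]; gcongr
    _ ≤ CY d * (4 * d) + 1 := by gcongr
    _ = MY d := by unfold MY; ring

end Summit.QuantumFields.BalabanUV.Beta.FP.PerfectSymbol166FlatFactors

end
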